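import Summits.HubbardSuperconductivity.HubbardLadder.ObservableWindow
import Summits.HubbardSuperconductivity.HubbardLadder.R3R4Sound
import HarnessLib

/-!
# The R2 ⇒ R3 edge, closed: a `PairCorrWindowCert` row from certified bounds on `Re ⟨ψ, O_r ψ⟩`

HONEST FRAMING: ladder R1–R4 with certified numbers; no claim on H/H₀.

`ObservableWindow.lean` (r2) proves `PairCorrWindowCert.ofExpectBounds` for an abstract operator `P` with
the hypothesis `hP : ∀ ψ, P̄_d(L, r; ψ) = L⁻² Re ⟨ψ, P ψ⟩`; `R3R4SoundWindow.lean` (r3) proves exactly that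
identity for the tree's pair-correlation operator `O_r = pairCorrOp L r = Σ_x Δ_x† Δ_{x+r}`
(`avgPairCorr_eq_re_expect_pairCorrOp`). This file is the three-line composition both docstrings defer to
"whoever lands second": certified `c_lo ≤ Re ⟨ψ, O_r ψ⟩ ≤ c_hi` over the normalised `(N L, S^z = 0)` sector
ground states of `H L` (from an SDP window certificate via `re_expect_sectorGS_ge_of_windowCertificate(_symm)`,
or from an ED enclosure) give the R3 table row `[c_lo / L², c_hi / L²]` at `(L, r)`, `L = m + 1`.
No new mathematics. [cite: QinEtAl2020, §II eqs. (2)–(4)]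
-/

namespace Summit.HubbardSuperconductivity.HubbardLadder

open Matrix Finset Filter Literature.Probability.LatticeModels
  Literature.MathematicalPhysics.QuantumLattice
open scoped ComplexOrder

noncomputable section

/-- **R2 ⇒ R3 row constructor for the concrete pair-correlation operator.** Certified bounds
`c_lo ≤ Re ⟨ψ, O_r ψ⟩ ≤ c_hi` for every normalised `(N (m+1), S^z = 0)` sector ground state of `H (m+1)`
give the `PairCorrWindowCert` row `[c_lo/(m+1)², c_hi/(m+1)²]` at `(L, r) = (m + 1, r)`.
(`PairCorrWindowCert.ofExpectBounds` with `P := pairCorrOp (m+1) r` and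
`hP := avgPairCorr_eq_re_expect_pairCorrOp m r`.) [cite: QinEtAl2020, §II eqs. (2)–(4)] -/
def PairCorrWindowCert.ofPairCorrOpBounds {H : TorusHamiltonianFamily} {N : ℕ → ℕ} (m : ℕ)
    (r : Site 2) (clo chi : ℝ)
    (hlo : ∀ ψ : Fock (Orb (FermionTorus 2 (m + 1))), star ψ ⬝ᵥ ψ = 1 →
      IsGroundStateInSector (H (m + 1)) (N (m + 1)) 0 ψ →
        clo ≤ (star ψ ⬝ᵥ pairCorrOp (m + 1) r *ᵥ ψ).re)
    (hhi : ∀ ψ : Fock (Orb (FermionTorus 2 (m + 1))), star ψ ⬝ᵥ ψ = 1 →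
      IsGroundStateInSector (H (m + 1)) (N (m + 1)) 0 ψ →
        (star ψ ⬝ᵥ pairCorrOp (m + 1) r *ᵥ ψ).re ≤ chi) :
    PairCorrWindowCert H N (m + 1) r :=
  PairCorrWindowCert.ofExpectBounds (H := H) (N := N) (pairCorrOp (m + 1) r)
    (avgPairCorr_eq_re_expect_pairCorrOp m r) clo chi hlo hhi

/-- The endpoints of `PairCorrWindowCert.ofPairCorrOpBounds`, for the record. [folklore] -/
theorem PairCorrWindowCert.ofPairCorrOpBounds_lo_hi {H : TorusHamiltonianFamily} {N : ℕ → ℕ} (m : ℕ)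
    (r : Site 2) (clo chi : ℝ)
    (hlo : ∀ ψ : Fock (Orb (FermionTorus 2 (m + 1))), star ψ ⬝ᵥ ψ = 1 →
      IsGroundStateInSector (H (m + 1)) (N (m + 1)) 0 ψ →
        clo ≤ (star ψ ⬝ᵥ pairCorrOp (m + 1) r *ᵥ ψ).re)
    (hhi : ∀ ψ : Fock (Orb (FermionTorus 2 (m + 1))), star ψ ⬝ᵥ ψ = 1 →
      IsGroundStateInSector (H (m + 1)) (N (m + 1)) 0 ψ →
        (star ψ ⬝ᵥ pairCorrOp (m + 1) r *ᵥ ψ).re ≤ chi) :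
    (PairCorrWindowCert.ofPairCorrOpBounds (H := H) (N := N) m r clo chi hlo hhi).lo =
        clo / ((m + 1 : ℕ) : ℝ) ^ 2 ∧
      (PairCorrWindowCert.ofPairCorrOpBounds (H := H) (N := N) m r clo chi hlo hhi).hi =
        chi / ((m + 1 : ℕ) : ℝ) ^ 2 :=
  ⟨rfl, rfl⟩

/-- Soundness restated on `avgPairCorr` itself (what the R3 table consumes): every normalised sector
ground state has `c_lo/(m+1)² ≤ P̄_d(m+1, r; ψ) ≤ c_hi/(m+1)²`. [folklore] -/
theorem avgPairCorr_mem_window_of_pairCorrOpBounds {H : TorusHamiltonianFamily} {N : ℕ → ℕ} (m : ℕ)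
    (r : Site 2) (clo chi : ℝ)
    (hlo : ∀ ψ : Fock (Orb (FermionTorus 2 (m + 1))), star ψ ⬝ᵥ ψ = 1 →
      IsGroundStateInSector (H (m + 1)) (N (m + 1)) 0 ψ →
        clo ≤ (star ψ ⬝ᵥ pairCorrOp (m + 1) r *ᵥ ψ).re)
    (hhi : ∀ ψ : Fock (Orb (FermionTorus 2 (m + 1))), star ψ ⬝ᵥ ψ = 1 →
      IsGroundStateInSector (H (m + 1)) (N (m + 1)) 0 ψ →
        (star ψ ⬝ᵥ pairCorrOp (m + 1) r *ᵥ ψ).re ≤ chi)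
    (ψ : Fock (Orb (FermionTorus 2 (m + 1)))) (h1 : star ψ ⬝ᵥ ψ = 1)
    (hgs : IsGroundStateInSector (H (m + 1)) (N (m + 1)) 0 ψ) :
    clo / ((m + 1 : ℕ) : ℝ) ^ 2 ≤ avgPairCorr (m + 1) r ψ ∧
      avgPairCorr (m + 1) r ψ ≤ chi / ((m + 1 : ℕ) : ℝ) ^ 2 :=
  (PairCorrWindowCert.ofPairCorrOpBounds (H := H) (N := N) m r clo chi hlo hhi).sound ψ h1 hgs

end

end Summit.HubbardSuperconductivity.HubbardLadder
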